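import Literature.MathematicalPhysics.QuantumFieldTheory.Balaban1983to89.B10Eq18SigmaSU2
import Literature.MathematicalPhysics.QuantumFieldTheory.Balaban1983to89.B10Eq22Rescaling
import Literature.MathematicalPhysics.QuantumFieldTheory.Balaban1983to89.T4HaarSU2ExpChart
import Literature.MathematicalPhysics.QuantumFieldTheory.Balaban1983to89.B13HaarSigmaJacobian

/-!
# `Balaban1983to89.B10Eq18SigmaSU2Haar` — T. Bałaban, *Ultraviolet stability of three-dimensional lattice pure gauge
# field theories*, Commun. Math. Phys. **102** (1985) 255–275 [Balaban1985UV3], p. 260: the sentence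
# «we express the Haar measure dU′ as dU′ = σ(A′)dA′ … For example for SU(2) we have σ(A) = 1/2π² (sin|A|/|A|)²,
# … A = Σ_{a=1}^3 σ_aA^a» PROVED AT MEASURE LEVEL in print's Pauli letters — normalised Haar measure on `SU(2)` IS
# `σ_{SU(2)}(|A|) d³A` pushed forward by `A ↦ exp(iΣσ_aA^a)` on the ball `|A| < π` — BY NAME from the tree's quaternion
# exponential chart `T4HaarSU2ExpChart` (pub-balaban) through the Pauli ↔ quaternion dictionary; and the density RATIO
# `σ(A)/σ₀` so obtained equals the [Hel] (12) dictionary value `σrel(T_A) = det φ(T_A)` of `B13HaarSigma`/`B10Eq18SigmaSU2`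

statement-level skeleton of published theorems with citation tags; proofs where landed; nothing here is a claim
about the Yang–Mills mass gap

PDF held: `paper:balaban1985-cmp102-uv-stability-3d`; p. 260 [PDF 6] re-read by this seat from the x2 render
`pub-balaban/b2b-balaban-ref1/pages/1985-cmp102-uv-stability-3d/1985-cmp102-uv-stability-3d-p006-x2.png` (2026-08-22).

THE PRINTED TEXT.  p. 260 (verbatim): *"To write the integrals (13) in terms of the variables A′ we express the Haar
measure dU′ as dU′ = σ(A′)dA′ = σ₀ σ/σ₀ (A′)dA′, σ₀ = σ(0), where dA′ is the Lebesque measure on 𝔤, and σ(A′) is a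
density which can be calculated explicitly for all classical groups. For example for SU(2) we have
σ(A) = 1/2π² (sin|A|/|A|)², where |A| = Σ_{a=1}^{3} (A^a)² ⟦sic: the square root is not printed⟧, and an element A of
the Lie algebra is represented as A = Σ_{a=1}^{3} σ_aA^a, σ_a are the three Pauli matrices (generators of the Lie
algebra)."*  The group element is `exp iA` ((18): `exp i(A − D̃(A))U₁`).

WHAT IS REPRODUCED.  Mega-formalization `lit-balaban` (HOME `run/shared/lean/pub/lit-balaban/`), unit `lit-balaban-r07`
gen 18.  SKELETON rows: narrative display E18 of `lit-balaban-r07/ROWS-B10.md` §2 (row of record **B10.Eq21** names the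
σ-sentence in its depends-on cell).  State of the tree before this file: `B10Eq22Rescaling.sigmaSU2` transcribes print's
`σ(r) = (1/2π²)(sin r/r)²` and §8 there proves `∫_{|A|<π} σ(|A|) d³A = 1`; `B10Eq18SigmaSU2.sigmaRel_su2` proves
`σrel(T_A) = (sin|A|/|A|)²` for the matrix `T_A = 2[A]_×` of `−ad(iA)` in the Pauli coordinates `X(A) = iΣ A^aσ_a`
(`su2Coord`), i.e. print's `σ/σ₀` IN THE DICTIONARY `σ/σ₀ = det φ(−ad X)` of [Hel] Thm. 1.14 (12), the identification of
that determinant with the Haar density being QUOTED there (HONEST SCOPE (i) of `B10Eq18SigmaSU2`, caveat of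
`B10Eq22Rescaling` §8); and pub-balaban's `T4HaarSU2ExpChart.lintegral_haarProbability_su2_exp` ([folklore]-tagged, no
Bałaban page read there) proves for the tree's normalised Haar measure `haarProbability` on
`Matrix.specialUnitaryGroup (Fin 2) ℂ` the exponential-chart formula in QUATERNION letters,
`∫ F dHaar = (2π²)⁻¹ ∫_{‖x‖<π} F(exp(x₀i + x₁j + x₂k)) sinc²‖x‖ d³x`, the chart being typed through the fixed dictionary
`QuantumLattice.quatMatrix : ℍ → M₂(ℂ)` («orientation remark, not used» there).  THIS FILE closes the triangle in
PRINT'S letters: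
* §1 the dictionary `quatMatrix(x₀i + x₁j + x₂k) = X(x₂, x₁, x₀)` (`quatMatrix_imQuat`; the tree's `quatMatrix` sends
  `i, j, k` to `iσ₃, iσ₂, iσ₁`, so the two coordinate systems differ by the coordinate REVERSAL `rev`, a linear isometry
  of `ℝ³`), composed with the tree's `T4QuatExpLog.quatMatrix_exp` (`quatMatrix(exp q) = exp(quatMatrix q)`):
  `quatMatrix(exp(x₀i + x₁j + x₂k)) = exp(iΣ A^aσ_a)`, `A = rev x` (`quatMatrix_exp_imQuat`);
* §2 the chart in print's letters, `expPauli A = exp(iΣσ_aA^a) ∈ SU(2)` (`coe_expPauli`, `expPauli_eq_expPoint`: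
  `= T4HaarSU2ExpChart.expPoint (rev A)`), the SU(2) Euler formula **`exp(iA) = cos|A|·1 + (sin|A|/|A|)·iA`**
  (`exp_su2Coord`), `expPauli 0 = 1`, continuity/measurability, and **injectivity of `A ↦ exp(iA)` on `|A| < π`**
  (`injOn_expPauli`, from `T4HaarSU2ExpChart.injOn_expPoint`);
* §3 **THE SENTENCE AT MEASURE LEVEL**: for every measurable `F : SU(2) → [0,∞]`,
  `∫ F dHaar = ∫_{|A|<π} F(exp(iΣσ_aA^a)) σ_{SU(2)}(|A|) d³A` (`lintegral_haarProbability_eq_pauli`; `d³A` = Lebesgue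
  measure of `EuclideanSpace ℝ (Fin 3)`, `|A|` its Euclidean norm, `σ_{SU(2)} = B10Eq22Rescaling.sigmaSU2`); the Bochner
  form (`integral_haarProbability_eq_pauli`); «dU′ = σ(A′)dA′» as a push-forward identity `(σ(|A|)1_{|A|<π}d³A) ∘
  expPauli⁻¹ = Haar` (`sigmaMeasure`, `map_expPauli_sigmaMeasure`), total mass `1` (`sigmaMeasure_univ` — a second,
  chart-theoretic certificate of the printed `σ₀ = 1/2π²`, independent of `B10Eq22Rescaling.integral_sigmaSU2_ball`);
  Haar measure of the chart windows `exp(i·W)`, `W ⊆ {|A| < π}` Borel (`haarProbability_restrict_image_expPauli`,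
  `haarProbability_image_expPauli`) — the windows `{|A(b)| < g₀p²(g₀)}` of (18) are such `W` once `g₀p²(g₀) < π`;
* §4 **THE DICTIONARY VERIFIED**: `σ_{SU(2)}(|A|)/σ_{SU(2)}(0) = σrel(T_A)` (`sigmaSU2_ratio_eq_sigmaRel`) — the ACTUAL
  Haar density ratio of §3 equals `det φ(T_A)`, [Hel] (12)'s `det((1 − e^{−ad X})/ad X)` in the Pauli coordinates
  (`B10Eq18SigmaSU2.adMat_su2Coord`): [Helgason2000] Ch. I §1 Thm. 1.14 is thereby VERIFIED for `G = SU(2)` at measure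
  level (for general compact `G` it stays quoted; the Jacobian-level identification for linear groups is r10's
  `B13HaarSigmaJacobian`).
* (v1.2, APPEND-ONLY §5, placed after §8 in the file) **[Hel] Thm 1.14 (13) LITERALLY for SU(2)**: `σ_{SU(2)}(|A|) = σ₀ · det jac(iA)`
  — the measure-level Haar density of §3 is `σ₀ = 1/2π²` times the determinant of the left-trivialised differential
  `jac(iA) = g(ad_𝔤(iA))` of the exponential chart (r10's `B13HaarSigmaJacobian.det_jac_su2`, v1.1 p319508, by name;
  `sigmaSU2_eq_sigma0_mul_det_jac`, `lintegral_haarProbability_eq_det_jac`: `∫ F dU = σ₀ ∫_{|A|<π} F(exp iA) det jac(iA) d³A`);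
* (v1.1, APPEND-ONLY §§6–8) §6 **(16) p. 259**, the constant `1/σ₀` in
  front of `δ(Q(A′,c))` «concentrated at the origin of 𝔤», one variable, as measures: `(exp i·)_* δ₀ = δ_1`
  (`map_expPauli_dirac_zero`), `σ·δ₀ = σ₀·δ₀` (`dirac_withDensity_sigmaSU2`), `δ₀ = (1/σ₀)·(σ·δ₀)` (`dirac_eq_inv_sigma0_smul`);
  §7 the small-field window `χ({|A(b)| < g₀p²(g₀)})` of (18) as a chart window (`haarProbability_smallFieldWindow`,
  `injOn_expPauli_smallFieldWindow`, radius `≤ π`); §8 **MANY BONDS**, (13) → (18): the configuration chart over a finite bond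
  set pushes `Π_b σ(A′(b))dA′(b)` to `Π_b dU′(b)` (`measurePreserving_pi_expPauli`, `map_pi_expPauli`,
  `lintegral_pi_haarProbability_eq_pauli`; Mathlib `measurePreserving_pi`) — the many-bond assembly left open in pub-balaban's
  `T4HaarSU2ExpChart` caveat (FIBRE), in print's letters.

HONEST SCOPE.  (i) Nothing of `T4HaarSU2ExpChart`, `T4QuatExpLog`, `B10Eq18SigmaSU2`, `B10Eq22Rescaling`, `B13HaarSigma` is
re-proved;
the measure-level content is pub-balaban's chart theorem, transported along the coordinate reversal.  (ii) `SU(2)` only: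
print's «can be calculated explicitly for all classical groups» is not touched (no exponential-chart Haar density for
`SU(N)`, `N ≥ 3`, exists in the tree).  (iii) The statement is about the tree's `haarProbability` (= Mathlib
`haarMeasure ⊤`, total mass 1) — print's `dU′` is the normalised Haar measure of one bond variable.  (iv) No claim about
(13)/(18) themselves (products over bonds, δ-functions, `D̃`): only the one-variable sentence «dU′ = σ(A′)dA′» and its
SU(2) example — v1.1 §8 adds the product over a finite bond set (the measure-theoretic content of «∫dU′↾_{Ω₁}» → «∫dA′↾_{Ω₁}»;
the δ-functions, `D̃` and the action in (13)/(18) stay untouched).  (v) §5 (v1.2) imports r10's `B13HaarSigmaJacobian`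
BY NAME; nothing of it is re-proved; Helgason's normalisation of `μ` is not discussed (print's `σ₀` is the tree's Haar
probability normalisation).  3 definitions (plumbing: the coordinate reversal `rev` between the two fixed dictionaries of the
tree, the chart `expPauli`, the measure `sigmaMeasure` = print's «σ(A)dA» on the injectivity ball), 0 new named facts.
-/

noncomputable section

open MeasureTheory MeasureTheory.Measure Set Metric NormedSpace
open scoped Quaternion ENNReal

namespace Literature.MathematicalPhysics.QuantumFieldTheory.Balaban1983to89.B10Eq18SigmaSU2Haar

open Literature.MathematicalPhysics.QuantumLattice (quatMatrix quatToSU2 quatMatrix_smul coe_quatToSU2_of_norm_eq_one)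
open Literature.MathematicalPhysics.QuantumFieldTheory (haarProbability)
open T4HaarSU2ExpChart B10Eq18SigmaSU2 B10Eq22Rescaling B13HaarSigma

/-! ## §1  The Pauli ↔ quaternion dictionary: `quatMatrix(x₀i + x₁j + x₂k) = X(x₂, x₁, x₀)`, `quatMatrix ∘ exp = exp ∘ quatMatrix` -/

section Dictionary

/-- THE COORDINATE REVERSAL `(A⁰, A¹, A²) ↦ (A², A¹, A⁰)` of `ℝ³ = EuclideanSpace ℝ (Fin 3)`, a linear isometry (Mathlib
`LinearIsometryEquiv.piLpCongrLeft` of the transposition `0 ↔ 2`): the change of coordinates between print's Pauli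
coordinates «A = Σ_{a=1}^3 σ_aA^a» (`B10Eq18SigmaSU2.su2Coord`) and the quaternion coordinates `x₀i + x₁j + x₂k` of the
tree's chart `T4HaarSU2ExpChart.expPoint` (the tree's `QuantumLattice.quatMatrix` sends `i, j, k` to `iσ₃, iσ₂, iσ₁`).
[cite: Balaban1985UV3, p. 260] -/
def rev : EuclideanSpace ℝ (Fin 3) ≃ₗᵢ[ℝ] EuclideanSpace ℝ (Fin 3) :=
  LinearIsometryEquiv.piLpCongrLeft 2 ℝ ℝ (Equiv.swap (0 : Fin 3) 2)

/-- `(rev A)_i = A_{swap(0,2) i}`. [cite: Balaban1985UV3, p. 260] -/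
@[simp] theorem rev_apply (A : EuclideanSpace ℝ (Fin 3)) (i : Fin 3) : rev A i = A (Equiv.swap (0 : Fin 3) 2 i) := by
  simp [rev, LinearIsometryEquiv.piLpCongrLeft_apply, Equiv.piCongrLeft'_apply, Equiv.symm_swap]

/-- `rev` is an involution. [cite: Balaban1985UV3, p. 260] -/
@[simp] theorem rev_rev (A : EuclideanSpace ℝ (Fin 3)) : rev (rev A) = A := by
  ext i
  rw [rev_apply, rev_apply, Equiv.swap_apply_self]

/-- `rev` preserves print's `|A|` (Euclidean norm). [cite: Balaban1985UV3, p. 260] -/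
@[simp] theorem norm_rev (A : EuclideanSpace ℝ (Fin 3)) : ‖rev A‖ = ‖A‖ := rev.norm_map A

/-- `rev` maps the ball `|A| < π` onto itself (as a preimage). [cite: Balaban1985UV3, p. 260] -/
theorem rev_preimage_ball (r : ℝ) :
    rev ⁻¹' ball (0 : EuclideanSpace ℝ (Fin 3)) r = ball (0 : EuclideanSpace ℝ (Fin 3)) r := by
  ext A
  simp

/-- `rev` preserves Lebesgue measure `d³A` (a linear isometry of a finite-dimensional real Hilbert space). [cite: Balaban1985UV3, p. 260] -/
theorem measurePreserving_rev : MeasurePreserving rev (volume : Measure (EuclideanSpace ℝ (Fin 3))) volume :=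
  rev.measurePreserving

/-- `rev` is a measurable embedding (a homeomorphism). [cite: Balaban1985UV3, p. 260] -/
theorem measurableEmbedding_rev : MeasurableEmbedding rev := rev.toHomeomorph.measurableEmbedding

/-- `quatMatrix` is additive. [folklore] -/
private theorem quatMatrix_add (p q : ℍ) : quatMatrix (p + q) = quatMatrix p + quatMatrix q := by
  ext i j
  fin_cases i <;> fin_cases j <;> apply Complex.ext <;> simp [quatMatrix] <;> ring

/-- `quatMatrix` of a real quaternion `r` is the scalar matrix `r·1`. [folklore] -/
private theorem quatMatrix_coe (r : ℝ) : quatMatrix (r : ℍ) = (r : ℂ) • (1 : Matrix (Fin 2) (Fin 2) ℂ) := by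
  ext i j
  fin_cases i <;> fin_cases j <;> apply Complex.ext <;> simp [quatMatrix]

/-- **THE DICTIONARY**: the tree's quaternion matrix of `x₀i + x₁j + x₂k` (`T4HaarSU2ExpChart.imQuat x`) is print's
`iA = iΣ_a A^aσ_a` (`B10Eq18SigmaSU2.su2Coord`) with `A = (x₂, x₁, x₀) = rev x`. [cite: Balaban1985UV3, p. 260] -/
theorem quatMatrix_imQuat (x : EuclideanSpace ℝ (Fin 3)) : quatMatrix (imQuat x) = su2Coord (rev x) := by
  ext i j
  fin_cases i <;> fin_cases j <;> apply Complex.ext <;>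
    simp [quatMatrix, imQuat_apply, su2Coord, Equiv.swap_apply_def]

/-- The same with the reversal on the quaternion side: `quatMatrix(ι(rev A)) = iΣ_a A^aσ_a`. [cite: Balaban1985UV3, p. 260] -/
theorem quatMatrix_imQuat_rev (A : EuclideanSpace ℝ (Fin 3)) : quatMatrix (imQuat (rev A)) = su2Coord A := by
  rw [quatMatrix_imQuat, rev_rev]

/-- **`quatMatrix(exp(x₀i + x₁j + x₂k)) = exp(iΣ_a A^aσ_a)`, `A = rev x`**: the quaternion chart IS print's `exp iA` — the
tree's `T4QuatExpLog.quatMatrix_exp` (`quatMatrix` is a continuous ring homomorphism, so it commutes with `exp`; the matrix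
exponential on the right) composed with the dictionary. [cite: Balaban1985UV3, p. 260] -/
theorem quatMatrix_exp_imQuat (x : EuclideanSpace ℝ (Fin 3)) : quatMatrix (exp (imQuat x)) = exp (su2Coord (rev x)) := by
  rw [T4QuatExpLog.quatMatrix_exp, quatMatrix_imQuat]

end Dictionary

/-! ## §2  The chart in print's letters: `expPauli A = exp(iΣσ_aA^a) ∈ SU(2)`, Euler's formula, injectivity on `|A| < π` -/

section Chart

/-- The matrix of the tree's chart point at the reversed coordinates is print's group element:
`expPoint(rev A) = exp(iΣ_a A^aσ_a)` as `2 × 2` matrices. [cite: Balaban1985UV3, p. 260] -/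
theorem coe_expPoint_rev (A : EuclideanSpace ℝ (Fin 3)) :
    ((expPoint (rev A) : Matrix.specialUnitaryGroup (Fin 2) ℂ) : Matrix (Fin 2) (Fin 2) ℂ) = exp (su2Coord A) := by
  rw [expPoint, coe_quatToSU2_of_norm_eq_one (norm_exp_imQuat _), quatMatrix_exp_imQuat, rev_rev]

/-- `exp(iΣ_a A^aσ_a) ∈ SU(2)` (special unitary: it is the tree's chart point). [cite: Balaban1985UV3, p. 260] -/
theorem exp_su2Coord_mem (A : EuclideanSpace ℝ (Fin 3)) :
    exp (su2Coord A) ∈ Matrix.specialUnitaryGroup (Fin 2) ℂ := by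
  rw [← coe_expPoint_rev]
  exact (expPoint (rev A)).2

/-- **PRINT'S CHART `A ↦ exp iA`, `iA = iΣ_{a=1}^3 A^aσ_a`**, as a map `ℝ³ → SU(2)` (`ℝ³ = EuclideanSpace ℝ (Fin 3)`, so that
`‖A‖ = |A| = (Σ (A^a)²)^{1/2}`). [cite: Balaban1985UV3, p. 260] -/
def expPauli (A : EuclideanSpace ℝ (Fin 3)) : Matrix.specialUnitaryGroup (Fin 2) ℂ :=
  ⟨exp (su2Coord A), exp_su2Coord_mem A⟩

/-- The matrix of `expPauli A` is `exp(iΣ_a A^aσ_a)`. [cite: Balaban1985UV3, p. 260] -/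
@[simp] theorem coe_expPauli (A : EuclideanSpace ℝ (Fin 3)) :
    ((expPauli A : Matrix.specialUnitaryGroup (Fin 2) ℂ) : Matrix (Fin 2) (Fin 2) ℂ) = exp (su2Coord A) := rfl

/-- **`expPauli = expPoint ∘ rev`**: print's chart is the tree's quaternion chart in reversed coordinates. [cite: Balaban1985UV3, p. 260] -/
theorem expPauli_eq_expPoint (A : EuclideanSpace ℝ (Fin 3)) : expPauli A = expPoint (rev A) :=
  Subtype.ext (coe_expPoint_rev A).symm

/-- As functions: `expPauli = expPoint ∘ rev`. [cite: Balaban1985UV3, p. 260] -/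
theorem expPauli_eq_comp : expPauli = expPoint ∘ rev := funext expPauli_eq_expPoint

/-- **EULER'S FORMULA IN `SU(2)`: `exp(iA) = cos|A|·1 + (sin|A|/|A|)·iA`** for `iA = iΣ A^aσ_a` (`sinc r = sin r/r`,
`sinc 0 = 1`) — the closed form of the quaternion exponential (`T4HaarSU2ExpChart.exp_imQuat`, Mathlib
`Quaternion.exp_of_re_eq_zero`) read through the dictionary; equivalently `(iA)² = −|A|²·1`. [cite: Balaban1985UV3, p. 260] -/
theorem exp_su2Coord (A : EuclideanSpace ℝ (Fin 3)) :
    exp (su2Coord A) = (Real.cos ‖A‖ : ℂ) • (1 : Matrix (Fin 2) (Fin 2) ℂ) + (Real.sinc ‖A‖ : ℂ) • su2Coord A := by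
  rw [← quatMatrix_imQuat_rev, ← T4QuatExpLog.quatMatrix_exp, exp_imQuat, norm_rev, quatMatrix_add, quatMatrix_coe,
    quatMatrix_smul]

/-- The chart is centred at the identity: `exp(i·0) = 1`. [cite: Balaban1985UV3, p. 260] -/
theorem expPauli_zero : expPauli 0 = 1 := by
  rw [expPauli_eq_expPoint, map_zero, expPoint_zero]

/-- `A ↦ exp iA` is continuous. [cite: Balaban1985UV3, p. 260] -/
theorem continuous_expPauli : Continuous expPauli := by
  rw [expPauli_eq_comp]
  exact continuous_expPoint.comp rev.continuous

/-- `A ↦ exp iA` is measurable. [cite: Balaban1985UV3, p. 260] -/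
theorem measurable_expPauli : Measurable expPauli := continuous_expPauli.measurable

/-- **`A ↦ exp iA` IS INJECTIVE ON THE BALL `|A| < π`** (the injectivity radius of `SU(2) ≅ S³`; the sphere `|A| = π`
collapses to `−1`) — so the coordinates `A′` of p. 260 are honest coordinates on every window inside that ball (tree
`T4HaarSU2ExpChart.injOn_expPoint` transported by `rev`). [cite: Balaban1985UV3, p. 260] -/
theorem injOn_expPauli : InjOn expPauli (ball (0 : EuclideanSpace ℝ (Fin 3)) Real.pi) := by
  intro A hA B hB h
  rw [expPauli_eq_expPoint, expPauli_eq_expPoint] at h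
  have hA' : rev A ∈ ball (0 : EuclideanSpace ℝ (Fin 3)) Real.pi := by rwa [mem_ball_zero_iff, norm_rev, ← mem_ball_zero_iff]
  have hB' : rev B ∈ ball (0 : EuclideanSpace ℝ (Fin 3)) Real.pi := by rwa [mem_ball_zero_iff, norm_rev, ← mem_ball_zero_iff]
  have := injOn_expPoint hA' hB' h
  rw [← rev_rev A, ← rev_rev B, this]

/-- Chart windows are Borel: for a measurable `W ⊆ {|A| < π}` the set `exp(iW) ⊆ SU(2)` is measurable (Lusin–Souslin).
[cite: Balaban1985UV3, p. 260] -/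
theorem measurableSet_image_expPauli {W : Set (EuclideanSpace ℝ (Fin 3))} (hW : MeasurableSet W)
    (hWπ : W ⊆ ball (0 : EuclideanSpace ℝ (Fin 3)) Real.pi) : MeasurableSet (expPauli '' W) :=
  hW.image_of_continuousOn_injOn continuous_expPauli.continuousOn (injOn_expPauli.mono hWπ)

end Chart

/-! ## §3  «dU′ = σ(A′)dA′»: normalised Haar measure on `SU(2)` is `σ_{SU(2)}(|A|) d³A` through the chart `A ↦ exp iA` -/

section Haar

/-- Print's `σ_{SU(2)}(|A|)` (`B10Eq22Rescaling.sigmaSU2`) IS the tree's exponential-chart weight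
`T4HaarSU2ExpChart.expWeight A = (2π²)⁻¹ sinc²‖A‖`. [cite: Balaban1985UV3, p. 260] -/
theorem sigmaSU2_norm_eq_expWeight (A : EuclideanSpace ℝ (Fin 3)) : sigmaSU2 ‖A‖ = expWeight A := by
  unfold sigmaSU2 expWeight
  by_cases h : ‖A‖ = 0
  · rw [if_pos h, h, Real.sinc_zero, one_div]
  · rw [if_neg h, Real.sinc_of_ne_zero h, one_div]

/-- The weight as an `ℝ≥0∞`-product: `σ(|A|) = (1/2π²)·sinc²|A|`. [cite: Balaban1985UV3, p. 260] -/
theorem ofReal_sigmaSU2_norm (A : EuclideanSpace ℝ (Fin 3)) :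
    ENNReal.ofReal (sigmaSU2 ‖A‖) = ENNReal.ofReal (1 / (2 * Real.pi ^ 2)) * ENNReal.ofReal (Real.sinc ‖A‖ ^ 2) := by
  rw [sigmaSU2_norm_eq_expWeight, expWeight, ← ENNReal.ofReal_mul (by positivity), one_div]

/-- `A ↦ σ(|A|)` is continuous on `ℝ³`. [cite: Balaban1985UV3, p. 260] -/
theorem continuous_sigmaSU2_norm : Continuous fun A : EuclideanSpace ℝ (Fin 3) => sigmaSU2 ‖A‖ := by
  have h : (fun A : EuclideanSpace ℝ (Fin 3) => sigmaSU2 ‖A‖) = expWeight := funext sigmaSU2_norm_eq_expWeight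
  rw [h]
  exact continuous_expWeight

/-- `A ↦ σ(|A|)` is measurable. [cite: Balaban1985UV3, p. 260] -/
theorem measurable_sigmaSU2_norm : Measurable fun A : EuclideanSpace ℝ (Fin 3) => sigmaSU2 ‖A‖ :=
  continuous_sigmaSU2_norm.measurable

/-- **THE p. 260 SENTENCE AT MEASURE LEVEL: `∫_{SU(2)} F dU = ∫_{|A|<π} F(exp(iΣ_aσ_aA^a)) · 1/2π² (sin|A|/|A|)² d³A`**
for every measurable `F : SU(2) → [0,∞]` — normalised Haar measure `dU′` written in the coordinates `A′`, `dU′ = σ(A′)dA′`,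
`σ(A) = 1/2π² (sin|A|/|A|)²`, `dA` Lebesgue measure on `𝔤 = 𝔰𝔲(2) ≅ ℝ³` (Euclidean in the coordinates `A^a`), the chart
taken on its injectivity ball.  Proof: pub-balaban's quaternion exponential-chart formula
`T4HaarSU2ExpChart.lintegral_haarProbability_su2_exp` and the change of variables `x = rev A` (a measure-preserving
isometry fixing the ball and the radial weight), `expPoint(rev A) = exp iA`. [cite: Balaban1985UV3, p. 260] -/
theorem lintegral_haarProbability_eq_pauli (F : Matrix.specialUnitaryGroup (Fin 2) ℂ → ℝ≥0∞) (hF : Measurable F) :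
    ∫⁻ U, F U ∂(haarProbability (Matrix.specialUnitaryGroup (Fin 2) ℂ)) =
      ∫⁻ A in ball (0 : EuclideanSpace ℝ (Fin 3)) Real.pi, F (expPauli A) * ENNReal.ofReal (sigmaSU2 ‖A‖) := by
  rw [lintegral_haarProbability_su2_exp F hF]
  have hconst : ∫⁻ A in ball (0 : EuclideanSpace ℝ (Fin 3)) Real.pi, F (expPauli A) * ENNReal.ofReal (sigmaSU2 ‖A‖) =
      ENNReal.ofReal (1 / (2 * Real.pi ^ 2)) *
        ∫⁻ A in ball (0 : EuclideanSpace ℝ (Fin 3)) Real.pi, F (expPoint (rev A)) * ENNReal.ofReal (Real.sinc ‖rev A‖ ^ 2) := by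
    rw [← lintegral_const_mul' _ _ ENNReal.ofReal_ne_top]
    refine lintegral_congr fun A => ?_
    rw [ofReal_sigmaSU2_norm, expPauli_eq_expPoint, norm_rev]
    ring
  rw [hconst]
  congr 1
  have h := measurePreserving_rev.setLIntegral_comp_preimage_emb measurableEmbedding_rev
    (fun x => F (expPoint x) * ENNReal.ofReal (Real.sinc ‖x‖ ^ 2)) (ball (0 : EuclideanSpace ℝ (Fin 3)) Real.pi)
  rw [rev_preimage_ball] at h
  exact h.symm

/-- BOCHNER FORM: for `f : SU(2) → G` (real Banach space) a.e.-strongly measurable for Haar measure,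
`∫ f dU = ∫_{|A|<π} σ_{SU(2)}(|A|) • f(exp iA) d³A` (both sides `0` together when `f` is not integrable; from pub-balaban's
`T4HaarSU2ExpChart.integral_haarProbability_su2_exp` by the change of variables `x = rev A`). [cite: Balaban1985UV3, p. 260] -/
theorem integral_haarProbability_eq_pauli {G : Type*} [NormedAddCommGroup G] [NormedSpace ℝ G]
    (f : Matrix.specialUnitaryGroup (Fin 2) ℂ → G)
    (hf : AEStronglyMeasurable f (haarProbability (Matrix.specialUnitaryGroup (Fin 2) ℂ))) :
    ∫ U, f U ∂(haarProbability (Matrix.specialUnitaryGroup (Fin 2) ℂ)) =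
      ∫ A in ball (0 : EuclideanSpace ℝ (Fin 3)) Real.pi, sigmaSU2 ‖A‖ • f (expPauli A) := by
  rw [integral_haarProbability_su2_exp f hf]
  have h := measurePreserving_rev.setIntegral_preimage_emb measurableEmbedding_rev
    (fun x => expWeight x • f (expPoint x)) (ball (0 : EuclideanSpace ℝ (Fin 3)) Real.pi)
  rw [rev_preimage_ball] at h
  rw [← h]
  refine setIntegral_congr_fun measurableSet_ball fun A _ => ?_
  simp only [sigmaSU2_norm_eq_expWeight, expPauli_eq_expPoint, expWeight, norm_rev]

/-- PRINT'S «σ(A)dA» AS A MEASURE: `σ_{SU(2)}(|A|) 1_{|A|<π} d³A` on `ℝ³` (the chart law, carried by the injectivity ball).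
[cite: Balaban1985UV3, p. 260] -/
def sigmaMeasure : Measure (EuclideanSpace ℝ (Fin 3)) :=
  (volume.restrict (ball (0 : EuclideanSpace ℝ (Fin 3)) Real.pi)).withDensity fun A => ENNReal.ofReal (sigmaSU2 ‖A‖)

/-- Integration against `σ(A)dA`: `∫ H σ(A)dA = ∫_{|A|<π} H(A) σ_{SU(2)}(|A|) d³A` for every `H : ℝ³ → [0,∞]`.
[cite: Balaban1985UV3, p. 260] -/
theorem lintegral_sigmaMeasure (H : EuclideanSpace ℝ (Fin 3) → ℝ≥0∞) :
    ∫⁻ A, H A ∂sigmaMeasure = ∫⁻ A in ball (0 : EuclideanSpace ℝ (Fin 3)) Real.pi, H A * ENNReal.ofReal (sigmaSU2 ‖A‖) := by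
  rw [sigmaMeasure, lintegral_withDensity_eq_lintegral_mul_non_measurable _
    measurable_sigmaSU2_norm.ennreal_ofReal (Filter.Eventually.of_forall fun x => ENNReal.ofReal_lt_top) H]
  refine lintegral_congr fun A => ?_
  simp only [Pi.mul_apply, mul_comm]

/-- `σ(A)dA` is the tree's chart law `T4HaarSU2ExpChart.expMeasure` (same weight, same ball). [cite: Balaban1985UV3, p. 260] -/
theorem sigmaMeasure_eq_expMeasure : sigmaMeasure = expMeasure := by
  rw [sigmaMeasure, expMeasure]
  congr 1
  funext A
  rw [sigmaSU2_norm_eq_expWeight]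

/-- **«dU′ = σ(A′)dA′» AS A PUSH-FORWARD IDENTITY: `(exp i·)_* (σ_{SU(2)}(|A|) 1_{|A|<π} d³A) = dU`**, the normalised Haar
measure of `SU(2)`. [cite: Balaban1985UV3, p. 260] -/
theorem map_expPauli_sigmaMeasure :
    sigmaMeasure.map expPauli = haarProbability (Matrix.specialUnitaryGroup (Fin 2) ℂ) := by
  ext s hs
  rw [Measure.map_apply measurable_expPauli hs, ← lintegral_indicator_one (measurable_expPauli hs),
    lintegral_sigmaMeasure, ← lintegral_indicator_one hs,
    lintegral_haarProbability_eq_pauli _ (measurable_one.indicator hs)]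
  rfl

/-- TOTAL MASS: `∫_{|A|<π} σ_{SU(2)}(|A|) d³A = 1` in the form `σ(A)dA(ℝ³) = 1` — the printed normalisation `σ₀ = 1/2π²`
certified a second time, through the chart (the first certificate, by radial integration, is
`B10Eq22Rescaling.integral_sigmaSU2_ball`). [cite: Balaban1985UV3, p. 260] -/
theorem sigmaMeasure_univ : sigmaMeasure univ = 1 := by
  have h := congrArg (fun μ : Measure (Matrix.specialUnitaryGroup (Fin 2) ℂ) => μ univ) map_expPauli_sigmaMeasure
  simp only [Measure.map_apply measurable_expPauli MeasurableSet.univ, preimage_univ, measure_univ] at h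
  exact h

/-- `σ(A)dA` (restricted to the ball) is a probability measure. [cite: Balaban1985UV3, p. 260] -/
theorem isProbabilityMeasure_sigmaMeasure : IsProbabilityMeasure sigmaMeasure := ⟨sigmaMeasure_univ⟩

/-- **HAAR MEASURE ON A CHART WINDOW**: for every measurable `W ⊆ {|A| < π}`,
`dU|_{exp(iW)} = (exp i·)_* (σ(A)dA|_W)` — the form in which (18) uses the coordinates on the windows
`{|A(b)| < g₀p²(g₀)}` (push-forward identity, `Measure.restrict_map`, and `(exp i·)⁻¹(exp(iW)) ∩ {|A|<π} = W` by
injectivity). [cite: Balaban1985UV3, p. 260] -/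
theorem haarProbability_restrict_image_expPauli {W : Set (EuclideanSpace ℝ (Fin 3))} (hW : MeasurableSet W)
    (hWπ : W ⊆ ball (0 : EuclideanSpace ℝ (Fin 3)) Real.pi) :
    (haarProbability (Matrix.specialUnitaryGroup (Fin 2) ℂ)).restrict (expPauli '' W) = (sigmaMeasure.restrict W).map expPauli := by
  rw [← map_expPauli_sigmaMeasure, Measure.restrict_map measurable_expPauli (measurableSet_image_expPauli hW hWπ)]
  congr 1
  rw [sigmaMeasure, ← restrict_withDensity measurableSet_ball, Measure.restrict_restrict
    (measurable_expPauli (measurableSet_image_expPauli hW hWπ)), Measure.restrict_restrict hW,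
    injOn_expPauli.preimage_image_inter hWπ, inter_eq_left.2 hWπ]

/-- **THE HAAR MASS OF A CHART WINDOW: `dU(exp(iW)) = ∫_W σ_{SU(2)}(|A|) d³A`** for every measurable `W ⊆ {|A| < π}`.
[cite: Balaban1985UV3, p. 260] -/
theorem haarProbability_image_expPauli {W : Set (EuclideanSpace ℝ (Fin 3))} (hW : MeasurableSet W)
    (hWπ : W ⊆ ball (0 : EuclideanSpace ℝ (Fin 3)) Real.pi) :
    haarProbability (Matrix.specialUnitaryGroup (Fin 2) ℂ) (expPauli '' W) = ENNReal.ofReal (∫ A in W, sigmaSU2 ‖A‖) := by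
  have himage : expPauli '' W = expPoint '' (rev '' W) := by
    rw [expPauli_eq_comp, image_comp]
  have hW' : MeasurableSet (rev '' W) := measurableEmbedding_rev.measurableSet_image' hW
  have hWπ' : rev '' W ⊆ ball (0 : EuclideanSpace ℝ (Fin 3)) Real.pi := by
    rintro _ ⟨A, hA, rfl⟩
    rw [mem_ball_zero_iff, norm_rev]
    exact mem_ball_zero_iff.1 (hWπ hA)
  rw [himage, haarProbability_image hW' hWπ',
    measurePreserving_rev.setIntegral_image_emb measurableEmbedding_rev expWeight W]
  congr 1
  refine setIntegral_congr_fun hW fun A _ => ?_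
  rw [sigmaSU2_norm_eq_expWeight, expWeight, expWeight, norm_rev]

end Haar

/-! ## §4  The dictionary verified: the Haar density ratio `σ(A)/σ₀` of §3 IS `det φ(T_A)` ([Hel] Thm. 1.14 for `SU(2)`) -/

section Dictionary

open scoped Matrix

/-- `|A|² = Σ (A^a)² = A·A` for the Euclidean norm on `ℝ³`. [cite: Balaban1985UV3, p. 260] -/
theorem norm_eq_sqrt_dotProduct (A : EuclideanSpace ℝ (Fin 3)) :
    ‖A‖ = Real.sqrt (dotProduct (A : Fin 3 → ℝ) (A : Fin 3 → ℝ)) := by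
  rw [EuclideanSpace.norm_eq]
  congr 1
  simp only [dotProduct, Real.norm_eq_abs, sq, abs_mul_abs_self]

/-- The ratio `σ_{SU(2)}(r)/σ_{SU(2)}(0) = (sin r/r)²` for `r ≠ 0` (and `= 1` at `r = 0`). [cite: Balaban1985UV3, p. 260] -/
theorem sigmaSU2_div_sigmaSU2_zero {r : ℝ} (hr : r ≠ 0) : sigmaSU2 r / sigmaSU2 0 = (Real.sin r / r) ^ 2 := by
  rw [sigmaSU2, sigmaSU2_zero, if_neg hr]
  have hc : (1 : ℝ) / (2 * Real.pi ^ 2) ≠ 0 := by positivity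
  field_simp

/-- **[Hel] Thm. 1.14 VERIFIED FOR `SU(2)`: the actual Haar density ratio equals the dictionary value,
`σ_{SU(2)}(|A|)/σ_{SU(2)}(0) = σrel(T_A) = det φ(T_A)`**, `T_A = 2[A]_×` the matrix of `−ad(iA)` in the Pauli coordinates
(`B10Eq18SigmaSU2.adMat_su2Coord`, `sigmaRel_su2`) — where by §3 `σ_{SU(2)}(|A|)` IS the density of normalised Haar measure in
the coordinates `A` (`lintegral_haarProbability_eq_pauli`).  Print's two descriptions of `σ/σ₀` — «density of the Haar
measure dU′ in the variables A′» and [Hel] (12) `det((1 − exp(−ad A))/ad A)` — agree for `SU(2)`. [cite: Balaban1985UV3, p. 260]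
[cite: Helgason2000, Ch. I §1 Thm. 1.14 (12) p. 96] -/
theorem sigmaSU2_ratio_eq_sigmaRel (A : EuclideanSpace ℝ (Fin 3)) :
    (((sigmaSU2 ‖A‖ / sigmaSU2 0 : ℝ)) : ℂ) = sigmaRel (((2 : ℝ) • crossMatrix (A : Fin 3 → ℝ)).map (algebraMap ℝ ℂ)) := by
  by_cases hA : (A : Fin 3 → ℝ) = 0
  · have hA0 : A = 0 := by
      ext i
      exact congr_fun hA i
    have hn : ‖A‖ = 0 := by rw [hA0, norm_zero]
    rw [hA, sigmaRel_su2_zero, hn, div_self (by rw [sigmaSU2_zero]; positivity)]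
    simp
  · have hn : ‖A‖ ≠ 0 := by
      intro h
      apply hA
      have : A = 0 := norm_eq_zero.1 h
      rw [this]
      rfl
    rw [sigmaRel_su2 hA, sigmaSU2_div_sigmaSU2_zero hn, norm_eq_sqrt_dotProduct]

/-- The same identity solved for the density: `σ_{SU(2)}(|A|) = σ₀ · Re σrel(T_A)`, `σ₀ = 1/2π²`. [cite: Balaban1985UV3, p. 260] -/
theorem sigmaSU2_eq_sigma0_mul_sigmaRel (A : EuclideanSpace ℝ (Fin 3)) :
    sigmaSU2 ‖A‖ = 1 / (2 * Real.pi ^ 2) * (sigmaRel (((2 : ℝ) • crossMatrix (A : Fin 3 → ℝ)).map (algebraMap ℝ ℂ))).re := by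
  rw [← sigmaSU2_ratio_eq_sigmaRel, Complex.ofReal_re, ← sigmaSU2_zero]
  have h0 : sigmaSU2 0 ≠ 0 := by rw [sigmaSU2_zero]; positivity
  field_simp

end Dictionary

/-! ## §6  (v1.1) (16) p. 259: the δ-function at the identity written in the coordinates `A′` carries the factor `1/σ₀`,
`σ₀ = σ(0)` -/

section Delta

/-- (16) p. 259 *"Π_{c∈Ω₁^{(1)}} δ((U′U₁)‾(c)(Ū₁(c))⁻¹) = Π_c (1/σ₀) δ(Q(A′,c)), where the δ-functions on the right are defined
on the vector space 𝔤, and concentrated at the origin of this space. The constant σ₀ will be discussed later"* + p. 260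
«σ₀ = σ(0)», ONE VARIABLE, as measures: the unit mass at the identity of `SU(2)` is the image of the unit mass at the
origin of `𝔤` under the chart `A ↦ exp iA`. [cite: Balaban1985UV3, (16) p. 259] -/
theorem map_expPauli_dirac_zero :
    (Measure.dirac (0 : EuclideanSpace ℝ (Fin 3))).map expPauli =
      Measure.dirac (1 : Matrix.specialUnitaryGroup (Fin 2) ℂ) := by
  rw [Measure.map_dirac' measurable_expPauli, expPauli_zero]

/-- … and against the Haar density `σ(A)dA` the unit mass at the origin weighs `σ(0) = σ₀`: `σ · δ₀ = σ₀ · δ₀` — whence the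
printed factor `1/σ₀` in front of `δ(Q(A′,c))` when `dU′` is rewritten as `σ(A′)dA′`. [cite: Balaban1985UV3, (16) p. 259] -/
theorem dirac_withDensity_sigmaSU2 :
    (Measure.dirac (0 : EuclideanSpace ℝ (Fin 3))).withDensity (fun A => ENNReal.ofReal (sigmaSU2 ‖A‖)) =
      ENNReal.ofReal (sigmaSU2 0) • Measure.dirac (0 : EuclideanSpace ℝ (Fin 3)) := by
  rw [dirac_withDensity' measurable_sigmaSU2_norm.ennreal_ofReal, norm_zero]

/-- **(16): `δ₀ = (1/σ₀) · (σ · δ₀)`** — the δ-function «concentrated at the origin of 𝔤» with the constant `1/σ₀`,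
`σ₀ = σ(0) = 1/2π²` for `SU(2)`. [cite: Balaban1985UV3, (16) p. 259] -/
theorem dirac_eq_inv_sigma0_smul :
    Measure.dirac (0 : EuclideanSpace ℝ (Fin 3)) =
      (ENNReal.ofReal (sigmaSU2 0))⁻¹ •
        (Measure.dirac (0 : EuclideanSpace ℝ (Fin 3))).withDensity (fun A => ENNReal.ofReal (sigmaSU2 ‖A‖)) := by
  rw [dirac_withDensity_sigmaSU2, smul_smul]
  have h0 : ENNReal.ofReal (sigmaSU2 0) ≠ 0 := by
    rw [sigmaSU2_zero]; exact (ENNReal.ofReal_pos.mpr (by positivity)).ne'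
  rw [ENNReal.inv_mul_cancel h0 ENNReal.ofReal_ne_top, one_smul]

end Delta

/-! ## §7  (v1.1) The small-field window of (18): `χ({|A(b)| < g₀p²(g₀)})` — Haar mass of a chart ball -/

section Window

/-- THE SMALL-FIELD WINDOW OF (18) IN HAAR TERMS (one bond): for a radius `ρ ≤ π` (print: `ρ = g₀p²(g₀)`, «g₀ sufficiently
small»), the set `{exp iA : |A| < ρ} ⊆ SU(2)` is Borel and `dU({exp iA : |A| < ρ}) = ∫_{|A|<ρ} σ_{SU(2)}(|A|) d³A` — the
window `χ({|A(b)| < g₀p²(g₀)})` of (18) is a chart window inside the injectivity ball. [cite: Balaban1985UV3, (18) p. 260] -/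
theorem haarProbability_smallFieldWindow {ρ : ℝ} (hρ : ρ ≤ Real.pi) :
    haarProbability (Matrix.specialUnitaryGroup (Fin 2) ℂ) (expPauli '' ball (0 : EuclideanSpace ℝ (Fin 3)) ρ) =
      ENNReal.ofReal (∫ A in ball (0 : EuclideanSpace ℝ (Fin 3)) ρ, sigmaSU2 ‖A‖) :=
  haarProbability_image_expPauli measurableSet_ball (ball_subset_ball hρ)

/-- On the window the coordinates are honest: `A ↦ exp iA` is injective on `{|A| < ρ}`, `ρ ≤ π`. [cite: Balaban1985UV3, (18) p. 260] -/
theorem injOn_expPauli_smallFieldWindow {ρ : ℝ} (hρ : ρ ≤ Real.pi) :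
    InjOn expPauli (ball (0 : EuclideanSpace ℝ (Fin 3)) ρ) :=
  injOn_expPauli.mono (ball_subset_ball hρ)

end Window

/-! ## §8  (v1.1) MANY BONDS: `∫dU′↾_{Ω₁}` of (13) as `∫ Π_{b∈Ω₁} σ(A′(b))dA′(b)` of (18) — the product of the one-bond laws -/

section ManyBonds

/-- The one-bond chart is measure preserving: `(exp i·)_* (σ(A)dA on the ball) = dU`. [cite: Balaban1985UV3, p. 260] -/
theorem measurePreserving_expPauli :
    MeasurePreserving expPauli sigmaMeasure (haarProbability (Matrix.specialUnitaryGroup (Fin 2) ℂ)) :=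
  ⟨measurable_expPauli, map_expPauli_sigmaMeasure⟩

/-- **MANY BONDS ((13) → (18)): for a finite bond set `Ω₁`, the configuration chart `(A′(b))_b ↦ (exp iA′(b))_b` pushes the
product law `Π_{b∈Ω₁} σ(A′(b))dA′(b)` (each factor on its injectivity ball) to the product Haar measure `Π_{b∈Ω₁} dU′(b)`** —
«we express the Haar measure dU′ as dU′ = σ(A′)dA′» applied bond by bond under `∫dU′↾_{Ω₁}` (Mathlib `measurePreserving_pi`;
the many-bond assembly left open in pub-balaban's `T4HaarSU2ExpChart` caveat (FIBRE), in print's letters).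
[cite: Balaban1985UV3, (13) p. 259, (18) p. 260] -/
theorem measurePreserving_pi_expPauli (ι : Type*) [Fintype ι] :
    MeasurePreserving (fun (A : ι → EuclideanSpace ℝ (Fin 3)) (b : ι) => expPauli (A b))
      (Measure.pi fun _ : ι => sigmaMeasure)
      (Measure.pi fun _ : ι => haarProbability (Matrix.specialUnitaryGroup (Fin 2) ℂ)) :=
  measurePreserving_pi _ _ fun _ => measurePreserving_expPauli

/-- The push-forward form: `(Π_b σ(A′(b))dA′(b)) ∘ (exp i·)⁻¹ = Π_b dU′(b)`. [cite: Balaban1985UV3, (13) p. 259, (18) p. 260] -/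
theorem map_pi_expPauli (ι : Type*) [Fintype ι] :
    (Measure.pi fun _ : ι => sigmaMeasure).map (fun (A : ι → EuclideanSpace ℝ (Fin 3)) (b : ι) => expPauli (A b)) =
      Measure.pi fun _ : ι => haarProbability (Matrix.specialUnitaryGroup (Fin 2) ℂ) :=
  (measurePreserving_pi_expPauli ι).map_eq

/-- **`∫ Π_b dU′(b) F(U′) = ∫ Π_b σ(A′(b))dA′(b) F((exp iA′(b))_b)`** for every measurable `F ≥ 0` on configurations over a
finite bond set — the integral `∫dU′↾_{Ω₁}` of (13) rewritten in the variables `A′` as in (18). [cite: Balaban1985UV3, (13) p. 259, (18) p. 260] -/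
theorem lintegral_pi_haarProbability_eq_pauli (ι : Type*) [Fintype ι]
    (F : (ι → Matrix.specialUnitaryGroup (Fin 2) ℂ) → ℝ≥0∞) (hF : Measurable F) :
    ∫⁻ U, F U ∂(Measure.pi fun _ : ι => haarProbability (Matrix.specialUnitaryGroup (Fin 2) ℂ)) =
      ∫⁻ A, F (fun b => expPauli (A b)) ∂(Measure.pi fun _ : ι => sigmaMeasure) :=
  ((measurePreserving_pi_expPauli ι).lintegral_comp hF).symm

end ManyBonds

/-! ## §5  (v1.2) [Hel] Thm 1.14 (13) LITERALLY for `SU(2)`: the Haar density is `σ₀` times the Jacobian determinant of the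
exponential chart — `σ_{SU(2)}(|A|) = σ₀ · det jac(iA)` (r10's `B13HaarSigmaJacobian.det_jac_su2` by name) -/

section Jacobian

-- r10's `B13HaarSigmaJacobian` §9 setting: `𝔰𝔲(2)` as a Lie subalgebra of the associative algebra `M₂(ℂ)` (file-local
-- instance, the idiom of `CompactKillingForm`/`B13HaarSigmaJacobian`; nothing global is overridden) and the operator norm.
attribute [local instance 100] LieRing.ofAssociativeRing

open scoped Matrix.Norms.Operator
open B13HaarSigmaJacobian
open Literature.Algebra.Lie.CompactKillingForm (su)

/-- **«dU′ = σ(A′)dA′» WITH `σ = σ₀ · det(d exp)`, i.e. [Helgason2000] Ch. I §1 Thm. 1.14 (13) `dμ = |det(d exp_X)| dX` (up to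
the normalisation `σ₀ = μ`-mass convention) LITERALLY for `G = SU(2)`**: the measure-level Haar density `σ_{SU(2)}(|A|)` of §3
(`lintegral_haarProbability_eq_pauli`) equals `σ₀ = 1/2π²` times the determinant of the left-trivialised differential
`jac(iA) = g(ad_𝔤(iA))` of the exponential chart at `iA ∈ 𝔰𝔲(2)` (r10's `B13HaarSigmaJacobian.jac`/`su2Equiv`, `det_jac_su2`:
`det jac(iA) = (sin|A|/|A|)²`).  [cite: Balaban1985UV3, p. 260] [cite: Helgason2000, Ch. I §1 Thm. 1.14 (13) p. 96] -/
theorem sigmaSU2_eq_sigma0_mul_det_jac (A : EuclideanSpace ℝ (Fin 3)) :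
    sigmaSU2 ‖A‖ = 1 / (2 * Real.pi ^ 2) *
      LinearMap.det (jac hlie_su2 (su2Equiv (A : Fin 3 → ℝ)) :
        (su (Fin 2)).toSubmodule →ₗ[ℝ] (su (Fin 2)).toSubmodule) := by
  by_cases hA : (A : Fin 3 → ℝ) = 0
  · have hA0 : A = 0 := by
      ext i
      exact congr_fun hA i
    rw [hA, det_jac_su2_zero, hA0, norm_zero, sigmaSU2_zero, mul_one]
  · have h := det_jac_su2 hA
    have hdet : LinearMap.det (jac hlie_su2 (su2Equiv (A : Fin 3 → ℝ)) :
        (su (Fin 2)).toSubmodule →ₗ[ℝ] (su (Fin 2)).toSubmodule) =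
        (Real.sin (Real.sqrt (dotProduct (A : Fin 3 → ℝ) (A : Fin 3 → ℝ))) /
          Real.sqrt (dotProduct (A : Fin 3 → ℝ) (A : Fin 3 → ℝ))) ^ 2 :=
      Complex.ofReal_injective h
    have hn : ‖A‖ ≠ 0 := by
      intro h0
      apply hA
      have : A = 0 := norm_eq_zero.1 h0
      rw [this]
      rfl
    rw [hdet, ← norm_eq_sqrt_dotProduct, sigmaSU2, if_neg hn]

/-- The same as a density statement: `∫ F dU = σ₀ ∫_{|A|<π} F(exp iA) det jac(iA) d³A` for measurable `F ≥ 0` — normalised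
Haar measure on `SU(2)` is `σ₀ · det(d exp) · Lebesgue` through the exponential chart on its injectivity ball.
[cite: Balaban1985UV3, p. 260] [cite: Helgason2000, Ch. I §1 Thm. 1.14 (13) p. 96] -/
theorem lintegral_haarProbability_eq_det_jac (F : Matrix.specialUnitaryGroup (Fin 2) ℂ → ℝ≥0∞) (hF : Measurable F) :
    ∫⁻ U, F U ∂(haarProbability (Matrix.specialUnitaryGroup (Fin 2) ℂ)) =
      ∫⁻ A in ball (0 : EuclideanSpace ℝ (Fin 3)) Real.pi, F (expPauli A) *
        ENNReal.ofReal (1 / (2 * Real.pi ^ 2) *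
          LinearMap.det (jac hlie_su2 (su2Equiv (A : Fin 3 → ℝ)) :
            (su (Fin 2)).toSubmodule →ₗ[ℝ] (su (Fin 2)).toSubmodule)) := by
  rw [lintegral_haarProbability_eq_pauli F hF]
  refine setLIntegral_congr_fun measurableSet_ball fun A _ => ?_
  rw [sigmaSU2_eq_sigma0_mul_det_jac]

end Jacobian

end Literature.MathematicalPhysics.QuantumFieldTheory.Balaban1983to89.B10Eq18SigmaSU2Haar

end
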